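import Summits.BirchSwinnertonDyer.BirchSwinnertonDyer.Theorems.ShaPrimaryTransferFiniteShaComponentTransferSelmerCubicE2RKRow
import Summits.BirchSwinnertonDyer.BirchSwinnertonDyer.Theorems.ShaPrimaryTransferFiniteShaComponentTransferSelmerCubicKillResidue
import HarnessLib

/-!
# BirchSwinnertonDyer — SEL2CUBIC door for the `checkE2RK` / `checkE2RKV` census rows: the `K`-free row shapes

HONEST FRAMING: route `ShaPrimaryTransfer`, seat `bsd-line-spt-p1` (g30), `--supports` item T =
`FiniteShaComponentTransfer` (stmt-22356), UNCHANGED (conjecture-grade at corank ≥ 2). BSD in rank ≥ 2 is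
NOT proved by any of this. THEOREMS ONLY.

The wrappers of `sha_door_of_checkE2RKV` (`…SelmerCubicE2RKRow`) in the exact argument shapes of the census rows:
`rank_eq_of_certsE2RKV{,_scaled,_complSq,_plain}` (`hk` in RESIDUE form, assembled by `killResidueE2_nil` /
`killResidueE2_cons` of `…SelmerCubicE2KRows` with `F := G.toE2`, `cc := ccr.cc` from `killResidue_of_<shape> …
(by decide +kernel)`, the census certificates UNCHANGED) and the monolithic `rank_eq_of_certsE2RK{,_scaled,_complSq,_plain}`
(`hk : killSearchE2 … = true`; `checkE2RKV_of_checkE2RK`, `killResidueE2R_of_search`). Every such row becomes an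
unconditional `t₂(E) = 0 ∧ rank E(ℚ) = r` door by swapping theorem names.
[cite: Cassels1991LecturesEllipticCurves, §15] [cite: SilvermanAEC2009, Thm. X.4.2, Rem. X.4.1]
[cite: CremonaAlgorithms1997, §3.6]
-/

-- single-conjunct summit: `Summit.BirchSwinnertonDyer.BirchSwinnertonDyer.…` repeats the name by design
set_option linter.dupNamespace false

noncomputable section

open scoped Classical NumberField nonZeroDivisors

open Literature.NumberTheory.NumberFields Literature.NumberTheory.EllipticCurves
  Literature.NumberTheory.GaloisRepresentations Polynomial Module NumberField IsDedekindDomain Ideal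
open WeierstrassCurve WeierstrassCurve.Affine

namespace Summit.BirchSwinnertonDyer.BirchSwinnertonDyer.Theorems.ShaPrimaryTransferSelmerCubicCover

open Summit.BirchSwinnertonDyer.BirchSwinnertonDyer.Rank2Observatory
open Summit.BirchSwinnertonDyer.BirchSwinnertonDyer.Rank2Observatory.TwoDescCubic
open Summit.BirchSwinnertonDyer.BirchSwinnertonDyer.Rank2Observatory.TwoDescCl
open Summit.BirchSwinnertonDyer.BirchSwinnertonDyer.Rank2Observatory.TwoDescCl.ClFieldCert
open Summit.BirchSwinnertonDyer.BirchSwinnertonDyer.Rank2Observatory.TwoDescKill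
open Summit.BirchSwinnertonDyer.BirchSwinnertonDyer.Theorems.ShaPrimaryTransferSelmerCubicKill

/-! ## `K`-free wrappers (the census rows' shapes) -/

section Rows

/-- **`K`-free door shape** (model `(0, A, 0, B, C)` read over `ℚ` from `ℤ`), in the exact shape of
`rank_eq_of_certsE2RKV` (`hk` in residue form): the row's arguments unchanged, the theorem name swapped.
[cite: Cassels1991LecturesEllipticCurves, §15] [cite: CremonaAlgorithms1997, §3.6] -/
theorem sha_door_of_certsE2RKV (r : ℕ) (G : ClFieldCertRE2) (ccr : ClCurveCertE2R) (h2 : G.check2R = true)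
    (hpr : G.toE2.fe.primeListE.Forall Nat.Prime) (ks : List ClKillE2) (hc : checkE2RKV G ccr r ks = true)
    (hk : ∀ k ∈ ks, k.p.Prime ∧ ∃ N : ℕ, ∀ v : ℤ × ℤ × ℤ × ℤ,
      ¬ ((k.p : ℤ) ∣ v.1 ∧ (k.p : ℤ) ∣ v.2.1 ∧ (k.p : ℤ) ∣ v.2.2.1 ∧ (k.p : ℤ) ∣ v.2.2.2) →
      (k.p : ℤ) ^ N ∣ (killQ G.toE2.fe.base.a G.toE2.fe.base.b G.toE2.fe.base.c (k.z G.toE2 ccr.cc) ccr.cc.Xt.2.1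
        ccr.cc.Xt.2.2 v).1 →
      (k.p : ℤ) ^ N ∣ (killQ G.toE2.fe.base.a G.toE2.fe.base.b G.toE2.fe.base.c (k.z G.toE2 ccr.cc) ccr.cc.Xt.2.1
        ccr.cc.Xt.2.2 v).2 → False)
    (hlow : r ≤ (((⟨0, ccr.cc.A, 0, ccr.cc.B, ccr.cc.C⟩ : WeierstrassCurve ℤ)).map (Int.castRingHom ℚ)).mordellWeilRank) :
    (((⟨0, ccr.cc.A, 0, ccr.cc.B, ccr.cc.C⟩ : WeierstrassCurve ℤ)).map (Int.castRingHom ℚ)).shaCorank 2 = 0 ∧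
      AddCommGroup.primaryComponent (((⟨0, ccr.cc.A, 0, ccr.cc.B, ccr.cc.C⟩ : WeierstrassCurve ℤ)).map (Int.castRingHom ℚ)).sha 2 = ⊥ ∧
        (((⟨0, ccr.cc.A, 0, ccr.cc.B, ccr.cc.C⟩ : WeierstrassCurve ℤ)).map (Int.castRingHom ℚ)).mordellWeilRank = r := by
  haveI : Fact (Irreducible (MonicCubic.polyQ G.toE2.fe.base.a G.toE2.fe.base.b G.toE2.fe.base.c)) :=
    ⟨G.toE2.fe.base.irreducible_of_reg (G.toE2.fe.checkReg_of_coreE (G.checkCoreE_of_check2R h2))⟩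
  exact sha_door_map_of_door (fun h => sha_door_of_checkE2RKV (K := CubicField G.toE2.fe.base.a G.toE2.fe.base.b G.toE2.fe.base.c) r G
      (CubicField.aeval_root _ _ _) (CubicField.finrank_eq _ _ _) h2 hpr ccr ks hc hk h) hlow

/-- `Δ ≠ 0` is the first clause of `checkE2RKV`. [folklore] -/
theorem deltaShort_ne_of_checkE2RKV {r : ℕ} {G : ClFieldCertRE2} {ccr : ClCurveCertE2R} {ks : List ClKillE2}
    (hc : checkE2RKV G ccr r ks = true) : deltaShort ccr.cc.A ccr.cc.B ccr.cc.C ≠ 0 := by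
  simp only [checkE2RKV, Bool.and_eq_true, decide_eq_true_eq] at hc
  exact hc.1.1.1.1.1.1.1.1.1.1.1.1.1.1.1.1.1.1.1

/-- **`t₂(E) = 0 ∧ rank E(ℚ) = r` for the ORIGINAL model** `(a₁, a₂, a₃, a₄, a₆)` when the records certify its
completed-square model RESCALED by `d`, in the shape of `rank_eq_of_certsE2RKV_scaled`.
[cite: CremonaAlgorithms1997, §3.6] [cite: SilvermanAEC2009, III.3.1(b), Thm. X.4.2] -/
theorem shaCorank_two_eq_zero_of_certsE2RKV_scaled (r : ℕ) (G : ClFieldCertRE2) (ccr : ClCurveCertE2R)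
    (h2 : G.check2R = true) (hpr : G.toE2.fe.primeListE.Forall Nat.Prime) (ks : List ClKillE2)
    (hc : checkE2RKV G ccr r ks = true)
    (hk : ∀ k ∈ ks, k.p.Prime ∧ ∃ N : ℕ, ∀ v : ℤ × ℤ × ℤ × ℤ,
      ¬ ((k.p : ℤ) ∣ v.1 ∧ (k.p : ℤ) ∣ v.2.1 ∧ (k.p : ℤ) ∣ v.2.2.1 ∧ (k.p : ℤ) ∣ v.2.2.2) →
      (k.p : ℤ) ^ N ∣ (killQ G.toE2.fe.base.a G.toE2.fe.base.b G.toE2.fe.base.c (k.z G.toE2 ccr.cc) ccr.cc.Xt.2.1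
        ccr.cc.Xt.2.2 v).1 →
      (k.p : ℤ) ^ N ∣ (killQ G.toE2.fe.base.a G.toE2.fe.base.b G.toE2.fe.base.c (k.z G.toE2 ccr.cc) ccr.cc.Xt.2.1
        ccr.cc.Xt.2.2 v).2 → False)
    (a₁ a₂ a₃ a₄ a₆ d : ℤ) (hd : d ≠ 0)
    (hABC : ccr.cc.A = d ^ 2 * (a₁ ^ 2 + 4 * a₂) ∧ ccr.cc.B = d ^ 4 * (8 * (a₁ * a₃ + 2 * a₄)) ∧
      ccr.cc.C = d ^ 6 * (16 * (a₃ ^ 2 + 4 * a₆)))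
    (hlow : r ≤ (((⟨a₁, a₂, a₃, a₄, a₆⟩ : WeierstrassCurve ℤ)).map (Int.castRingHom ℚ)).mordellWeilRank) :
    (((⟨a₁, a₂, a₃, a₄, a₆⟩ : WeierstrassCurve ℤ)).map (Int.castRingHom ℚ)).shaCorank 2 = 0 ∧
      (((⟨a₁, a₂, a₃, a₄, a₆⟩ : WeierstrassCurve ℤ)).map (Int.castRingHom ℚ)).mordellWeilRank = r := by
  haveI : Fact (Irreducible (MonicCubic.polyQ G.toE2.fe.base.a G.toE2.fe.base.b G.toE2.fe.base.c)) :=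
    ⟨G.toE2.fe.base.irreducible_of_reg (G.toE2.fe.checkReg_of_coreE (G.checkCoreE_of_check2R h2))⟩
  exact shaCorank_two_transport_scaled a₁ a₂ a₃ a₄ a₆ d hd hABC (deltaShort_ne_of_checkE2RKV hc)
    (fun h => sha_door_of_checkE2RKV (K := CubicField G.toE2.fe.base.a G.toE2.fe.base.b G.toE2.fe.base.c) r G
      (CubicField.aeval_root _ _ _) (CubicField.finrank_eq _ _ _) h2 hpr ccr ks hc hk h) hlow

/-- The plain completed-square shape (`d = 1`), in the shape of `rank_eq_of_certsE2RKV_complSq`.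
[cite: CremonaAlgorithms1997, §3.6] [cite: SilvermanAEC2009, Thm. X.4.2] -/
theorem shaCorank_two_eq_zero_of_certsE2RKV_complSq (r : ℕ) (G : ClFieldCertRE2) (ccr : ClCurveCertE2R)
    (h2 : G.check2R = true) (hpr : G.toE2.fe.primeListE.Forall Nat.Prime) (ks : List ClKillE2)
    (hc : checkE2RKV G ccr r ks = true)
    (hk : ∀ k ∈ ks, k.p.Prime ∧ ∃ N : ℕ, ∀ v : ℤ × ℤ × ℤ × ℤ,
      ¬ ((k.p : ℤ) ∣ v.1 ∧ (k.p : ℤ) ∣ v.2.1 ∧ (k.p : ℤ) ∣ v.2.2.1 ∧ (k.p : ℤ) ∣ v.2.2.2) →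
      (k.p : ℤ) ^ N ∣ (killQ G.toE2.fe.base.a G.toE2.fe.base.b G.toE2.fe.base.c (k.z G.toE2 ccr.cc) ccr.cc.Xt.2.1
        ccr.cc.Xt.2.2 v).1 →
      (k.p : ℤ) ^ N ∣ (killQ G.toE2.fe.base.a G.toE2.fe.base.b G.toE2.fe.base.c (k.z G.toE2 ccr.cc) ccr.cc.Xt.2.1
        ccr.cc.Xt.2.2 v).2 → False)
    (a₁ a₂ a₃ a₄ a₆ : ℤ)
    (hABC : ccr.cc.A = a₁ ^ 2 + 4 * a₂ ∧ ccr.cc.B = 8 * (a₁ * a₃ + 2 * a₄) ∧ ccr.cc.C = 16 * (a₃ ^ 2 + 4 * a₆))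
    (hlow : r ≤ (((⟨a₁, a₂, a₃, a₄, a₆⟩ : WeierstrassCurve ℤ)).map (Int.castRingHom ℚ)).mordellWeilRank) :
    (((⟨a₁, a₂, a₃, a₄, a₆⟩ : WeierstrassCurve ℤ)).map (Int.castRingHom ℚ)).shaCorank 2 = 0 ∧
      (((⟨a₁, a₂, a₃, a₄, a₆⟩ : WeierstrassCurve ℤ)).map (Int.castRingHom ℚ)).mordellWeilRank = r := by
  haveI : Fact (Irreducible (MonicCubic.polyQ G.toE2.fe.base.a G.toE2.fe.base.b G.toE2.fe.base.c)) :=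
    ⟨G.toE2.fe.base.irreducible_of_reg (G.toE2.fe.checkReg_of_coreE (G.checkCoreE_of_check2R h2))⟩
  exact shaCorank_two_transport_complSq a₁ a₂ a₃ a₄ a₆ hABC (deltaShort_ne_of_checkE2RKV hc)
    (fun h => sha_door_of_checkE2RKV (K := CubicField G.toE2.fe.base.a G.toE2.fe.base.b G.toE2.fe.base.c) r G
      (CubicField.aeval_root _ _ _) (CubicField.finrank_eq _ _ _) h2 hpr ccr ks hc hk h) hlow

/-- Door plumbing for a curve already given by a plain model (`a₁ = a₃ = 0`), in the shape of
`rank_eq_of_certsE2RKV_plain`. [cite: Cassels1991LecturesEllipticCurves, §15] -/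
theorem sha_door_of_certsE2RKV_plain (r : ℕ) (G : ClFieldCertRE2) (ccr : ClCurveCertE2R) (h2 : G.check2R = true)
    (hpr : G.toE2.fe.primeListE.Forall Nat.Prime) (ks : List ClKillE2) (hc : checkE2RKV G ccr r ks = true)
    (hk : ∀ k ∈ ks, k.p.Prime ∧ ∃ N : ℕ, ∀ v : ℤ × ℤ × ℤ × ℤ,
      ¬ ((k.p : ℤ) ∣ v.1 ∧ (k.p : ℤ) ∣ v.2.1 ∧ (k.p : ℤ) ∣ v.2.2.1 ∧ (k.p : ℤ) ∣ v.2.2.2) →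
      (k.p : ℤ) ^ N ∣ (killQ G.toE2.fe.base.a G.toE2.fe.base.b G.toE2.fe.base.c (k.z G.toE2 ccr.cc) ccr.cc.Xt.2.1
        ccr.cc.Xt.2.2 v).1 →
      (k.p : ℤ) ^ N ∣ (killQ G.toE2.fe.base.a G.toE2.fe.base.b G.toE2.fe.base.c (k.z G.toE2 ccr.cc) ccr.cc.Xt.2.1
        ccr.cc.Xt.2.2 v).2 → False)
    (a₂ a₄ a₆ : ℤ) (hABC : ccr.cc.A = a₂ ∧ ccr.cc.B = a₄ ∧ ccr.cc.C = a₆)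
    (hlow : r ≤ (((⟨0, a₂, 0, a₄, a₆⟩ : WeierstrassCurve ℤ)).map (Int.castRingHom ℚ)).mordellWeilRank) :
    (((⟨0, a₂, 0, a₄, a₆⟩ : WeierstrassCurve ℤ)).map (Int.castRingHom ℚ)).shaCorank 2 = 0 ∧
      AddCommGroup.primaryComponent (((⟨0, a₂, 0, a₄, a₆⟩ : WeierstrassCurve ℤ)).map (Int.castRingHom ℚ)).sha 2 = ⊥ ∧
        (((⟨0, a₂, 0, a₄, a₆⟩ : WeierstrassCurve ℤ)).map (Int.castRingHom ℚ)).mordellWeilRank = r := by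
  haveI : Fact (Irreducible (MonicCubic.polyQ G.toE2.fe.base.a G.toE2.fe.base.b G.toE2.fe.base.c)) :=
    ⟨G.toE2.fe.base.irreducible_of_reg (G.toE2.fe.checkReg_of_coreE (G.checkCoreE_of_check2R h2))⟩
  exact sha_door_transport_plain a₂ a₄ a₆ hABC
    (fun h => sha_door_of_checkE2RKV (K := CubicField G.toE2.fe.base.a G.toE2.fe.base.b G.toE2.fe.base.c) r G
      (CubicField.aeval_root _ _ _) (CubicField.finrank_eq _ _ _) h2 hpr ccr ks hc hk h) hlow

/-! ## The monolithic `checkE2RK` / `killSearchE2` rows -/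

/-- `checkE2RK` (light clause `lite`) implies `checkE2RKV` (light clause `liteV`), all other clauses identical.
[folklore] -/
theorem checkE2RKV_of_checkE2RK {G : ClFieldCertRE2} {ccr : ClCurveCertE2R} {r : ℕ} {ks : List ClKillE2}
    (hc : checkE2RK G ccr r ks = true) : checkE2RKV G ccr r ks = true := by
  simp only [checkE2RK, Bool.and_eq_true] at hc
  obtain ⟨⟨hrest, hlite⟩, hcount⟩ := hc
  simp only [checkE2RKV, Bool.and_eq_true]
  refine ⟨⟨hrest, ?_⟩, hcount⟩
  rw [List.all_eq_true] at hlite ⊢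
  intro k hkm
  have h := hlite k hkm
  simp only [ClKillE2.lite, ClKillE2.liteV, Bool.and_eq_true, decide_eq_true_eq] at h ⊢
  exact ⟨h.1.2, h.2⟩

/-- The monolithic residue searches `killSearchE2` (trees `killCheck` at primes `p ∈ killPrimes`, primality from
the light clauses of `checkE2RK`) give the kill hypothesis in residue form. [cite: CremonaAlgorithms1997, §3.6] -/
theorem killResidueE2R_of_search {G : ClFieldCertRE2} {ccr : ClCurveCertE2R} {r : ℕ} {ks : List ClKillE2}
    (hc : checkE2RK G ccr r ks = true) (hk : killSearchE2 G.toE2 ccr.cc ks = true) :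
    ∀ k ∈ ks, k.p.Prime ∧ ∃ N : ℕ, ∀ v : ℤ × ℤ × ℤ × ℤ,
      ¬ ((k.p : ℤ) ∣ v.1 ∧ (k.p : ℤ) ∣ v.2.1 ∧ (k.p : ℤ) ∣ v.2.2.1 ∧ (k.p : ℤ) ∣ v.2.2.2) →
      (k.p : ℤ) ^ N ∣ (killQ G.toE2.fe.base.a G.toE2.fe.base.b G.toE2.fe.base.c (k.z G.toE2 ccr.cc) ccr.cc.Xt.2.1
        ccr.cc.Xt.2.2 v).1 →
      (k.p : ℤ) ^ N ∣ (killQ G.toE2.fe.base.a G.toE2.fe.base.b G.toE2.fe.base.c (k.z G.toE2 ccr.cc) ccr.cc.Xt.2.1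
        ccr.cc.Xt.2.2 v).2 → False := by
  simp only [checkE2RK, Bool.and_eq_true] at hc
  obtain ⟨⟨-, hlite⟩, -⟩ := hc
  rw [List.all_eq_true] at hlite
  rw [killSearchE2, List.all_eq_true] at hk
  intro k hkm
  have h := hlite k hkm
  simp only [ClKillE2.lite, Bool.and_eq_true, decide_eq_true_eq] at h
  exact ⟨prime_of_mem_killPrimes h.1.1, killResidue_of_killCheck (prime_of_mem_killPrimes h.1.1) (hk k hkm)⟩

/-- **`K`-free door**, in the exact shape of `rank_eq_of_certsE2RK` (`hk : killSearchE2 … = true`).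
[cite: Cassels1991LecturesEllipticCurves, §15] [cite: CremonaAlgorithms1997, §3.6] -/
theorem sha_door_of_certsE2RK (r : ℕ) (G : ClFieldCertRE2) (ccr : ClCurveCertE2R) (h2 : G.check2R = true)
    (hpr : G.toE2.fe.primeListE.Forall Nat.Prime) (ks : List ClKillE2) (hc : checkE2RK G ccr r ks = true)
    (hk : killSearchE2 G.toE2 ccr.cc ks = true)
    (hlow : r ≤ (((⟨0, ccr.cc.A, 0, ccr.cc.B, ccr.cc.C⟩ : WeierstrassCurve ℤ)).map (Int.castRingHom ℚ)).mordellWeilRank) :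
    (((⟨0, ccr.cc.A, 0, ccr.cc.B, ccr.cc.C⟩ : WeierstrassCurve ℤ)).map (Int.castRingHom ℚ)).shaCorank 2 = 0 ∧
      AddCommGroup.primaryComponent (((⟨0, ccr.cc.A, 0, ccr.cc.B, ccr.cc.C⟩ : WeierstrassCurve ℤ)).map (Int.castRingHom ℚ)).sha 2 = ⊥ ∧
        (((⟨0, ccr.cc.A, 0, ccr.cc.B, ccr.cc.C⟩ : WeierstrassCurve ℤ)).map (Int.castRingHom ℚ)).mordellWeilRank = r :=
  sha_door_of_certsE2RKV r G ccr h2 hpr ks (checkE2RKV_of_checkE2RK hc) (killResidueE2R_of_search hc hk) hlow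

/-- In the shape of `rank_eq_of_certsE2RK_scaled`. [cite: CremonaAlgorithms1997, §3.6] [cite: SilvermanAEC2009, Thm. X.4.2] -/
theorem shaCorank_two_eq_zero_of_certsE2RK_scaled (r : ℕ) (G : ClFieldCertRE2) (ccr : ClCurveCertE2R)
    (h2 : G.check2R = true) (hpr : G.toE2.fe.primeListE.Forall Nat.Prime) (ks : List ClKillE2)
    (hc : checkE2RK G ccr r ks = true) (hk : killSearchE2 G.toE2 ccr.cc ks = true) (a₁ a₂ a₃ a₄ a₆ d : ℤ)
    (hd : d ≠ 0)
    (hABC : ccr.cc.A = d ^ 2 * (a₁ ^ 2 + 4 * a₂) ∧ ccr.cc.B = d ^ 4 * (8 * (a₁ * a₃ + 2 * a₄)) ∧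
      ccr.cc.C = d ^ 6 * (16 * (a₃ ^ 2 + 4 * a₆)))
    (hlow : r ≤ (((⟨a₁, a₂, a₃, a₄, a₆⟩ : WeierstrassCurve ℤ)).map (Int.castRingHom ℚ)).mordellWeilRank) :
    (((⟨a₁, a₂, a₃, a₄, a₆⟩ : WeierstrassCurve ℤ)).map (Int.castRingHom ℚ)).shaCorank 2 = 0 ∧
      (((⟨a₁, a₂, a₃, a₄, a₆⟩ : WeierstrassCurve ℤ)).map (Int.castRingHom ℚ)).mordellWeilRank = r :=
  shaCorank_two_eq_zero_of_certsE2RKV_scaled r G ccr h2 hpr ks (checkE2RKV_of_checkE2RK hc)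
    (killResidueE2R_of_search hc hk) a₁ a₂ a₃ a₄ a₆ d hd hABC hlow

/-- In the shape of `rank_eq_of_certsE2RK_complSq`. [cite: CremonaAlgorithms1997, §3.6] [cite: SilvermanAEC2009, Thm. X.4.2] -/
theorem shaCorank_two_eq_zero_of_certsE2RK_complSq (r : ℕ) (G : ClFieldCertRE2) (ccr : ClCurveCertE2R)
    (h2 : G.check2R = true) (hpr : G.toE2.fe.primeListE.Forall Nat.Prime) (ks : List ClKillE2)
    (hc : checkE2RK G ccr r ks = true) (hk : killSearchE2 G.toE2 ccr.cc ks = true) (a₁ a₂ a₃ a₄ a₆ : ℤ)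
    (hABC : ccr.cc.A = a₁ ^ 2 + 4 * a₂ ∧ ccr.cc.B = 8 * (a₁ * a₃ + 2 * a₄) ∧ ccr.cc.C = 16 * (a₃ ^ 2 + 4 * a₆))
    (hlow : r ≤ (((⟨a₁, a₂, a₃, a₄, a₆⟩ : WeierstrassCurve ℤ)).map (Int.castRingHom ℚ)).mordellWeilRank) :
    (((⟨a₁, a₂, a₃, a₄, a₆⟩ : WeierstrassCurve ℤ)).map (Int.castRingHom ℚ)).shaCorank 2 = 0 ∧
      (((⟨a₁, a₂, a₃, a₄, a₆⟩ : WeierstrassCurve ℤ)).map (Int.castRingHom ℚ)).mordellWeilRank = r :=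
  shaCorank_two_eq_zero_of_certsE2RKV_complSq r G ccr h2 hpr ks (checkE2RKV_of_checkE2RK hc)
    (killResidueE2R_of_search hc hk) a₁ a₂ a₃ a₄ a₆ hABC hlow

/-- In the shape of `rank_eq_of_certsE2RK_plain`. [cite: Cassels1991LecturesEllipticCurves, §15] -/
theorem sha_door_of_certsE2RK_plain (r : ℕ) (G : ClFieldCertRE2) (ccr : ClCurveCertE2R) (h2 : G.check2R = true)
    (hpr : G.toE2.fe.primeListE.Forall Nat.Prime) (ks : List ClKillE2) (hc : checkE2RK G ccr r ks = true)
    (hk : killSearchE2 G.toE2 ccr.cc ks = true) (a₂ a₄ a₆ : ℤ) (hABC : ccr.cc.A = a₂ ∧ ccr.cc.B = a₄ ∧ ccr.cc.C = a₆)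
    (hlow : r ≤ (((⟨0, a₂, 0, a₄, a₆⟩ : WeierstrassCurve ℤ)).map (Int.castRingHom ℚ)).mordellWeilRank) :
    (((⟨0, a₂, 0, a₄, a₆⟩ : WeierstrassCurve ℤ)).map (Int.castRingHom ℚ)).shaCorank 2 = 0 ∧
      AddCommGroup.primaryComponent (((⟨0, a₂, 0, a₄, a₆⟩ : WeierstrassCurve ℤ)).map (Int.castRingHom ℚ)).sha 2 = ⊥ ∧
        (((⟨0, a₂, 0, a₄, a₆⟩ : WeierstrassCurve ℤ)).map (Int.castRingHom ℚ)).mordellWeilRank = r :=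
  sha_door_of_certsE2RKV_plain r G ccr h2 hpr ks (checkE2RKV_of_checkE2RK hc) (killResidueE2R_of_search hc hk) a₂ a₄ a₆
    hABC hlow

end Rows

end Summit.BirchSwinnertonDyer.BirchSwinnertonDyer.Theorems.ShaPrimaryTransferSelmerCubicCover

end
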